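import Mathlib
import Summits.ValiantsHypothesis.ValiantsHypothesis.Theorems.GrenetZeonTwoDimCoefficientsScalingSeparableCert

/-!
# Crux `GrenetZeon.TwoDimCoefficients` (stmt-ValiantsHypothesis-8062), stub `stub_dualUnipotent`:
# scaling-closure — `n³ ≤ 2m²` for every hdeg pencil whose ray polynomial is squarefree over `ℂ(z)`

The general (not necessarily index-`n`) companion of ✓ `cube_le_two_mul_sq_of_index_squarefree`: ✓ `cube_le_two_mul_sq_of_raySeparable`
with the certificate produced by ✓ `exists_certificate_of_separable_map` and separability read off squarefreeness over the
characteristic-zero function field (`PerfectField.separable_iff_squarefree`):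

* ★★ `cube_le_two_mul_sq_of_raySquarefree` — unipotent dual representation with `deg D_k ≤ kn` (`k ≥ 2`), top companion order `J`
  (`[D_J]_{Jn} ≠ 0`, higher companions zero), ray polynomial `R = c + Σ_{e<J} [D_{e+1}]_{(e+1)n} t^{e+1}` SQUAREFREE over `ℂ(z)`
  ⟹ `n³ ≤ 2m²`.

HONEST FRAMING: a conditional rung; the stub `DualUnipotentBound`, both cruxes and `VP ≠ VNP` remain open.

References: T. Mignon, N. Ressayre, Int. Math. Res. Not. 2004:79, Thm. 1.1 (via the tree); folklore.
-/

-- single-conjunct layout `Summits/ValiantsHypothesis/ValiantsHypothesis`: the duplicated namespace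
-- component is mandated by the tree.
set_option linter.dupNamespace false
set_option autoImplicit false

noncomputable section

namespace Summit.ValiantsHypothesis.ValiantsHypothesis.Theorems.GrenetZeonTwoDimCoefficients.ScalingClosure

open MvPolynomial Matrix
open Literature.Computability.AlgebraicComplexity
open Summit.ValiantsHypothesis.ValiantsHypothesis.Cruxes.TwoDimCoefficients.DimTwoCases

/-- ★★ **`n³ ≤ 2m²` for hdeg pencils with squarefree ray polynomial** (`n = k + 3`, `m ≥ 2`).
[cite: MignonRessayre2004, Thm. 1.1 — via the tree; folklore] -/
theorem cube_le_two_mul_sq_of_raySquarefree {k m : ℕ} (A B : AffMat (k + 3) m) (hA : IsAffine A) (hB : IsAffine B)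
    (α β c : ℂ) (hc : c ≠ 0) (hβ : β ≠ 0) (hdet : A.det = MvPolynomial.C c)
    (hper : perPoly (Fin (k + 3)) ℂ =
      MvPolynomial.C α * A.det + MvPolynomial.C β * (A.adjugate * B).trace)
    (hm2 : 2 ≤ m) (D : ℕ → MvPolynomial (Fin (k + 3) × Fin (k + 3)) ℂ)
    (hD : ∀ j, D j = (det ((Polynomial.X : Polynomial (MvPolynomial (Fin (k + 3) × Fin (k + 3)) ℂ)) •
      B.map Polynomial.C + A.map Polynomial.C)).coeff j)
    (hdeg : ∀ j, 2 ≤ j → ∀ d, j * (k + 3) < d → homogeneousComponent d (D j) = 0)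
    {J : ℕ} (hJ1 : 1 ≤ J) (hJtop : homogeneousComponent (J * (k + 3)) (D J) ≠ 0)
    (hJ : ∀ j, J < j → j ≤ m → homogeneousComponent (j * (k + 3)) (D j) = 0)
    (hsq : Squarefree ((Polynomial.C (MvPolynomial.C c) + ∑ e : Fin J,
        Polynomial.C (homogeneousComponent (((e : ℕ) + 1) * (k + 3)) (D (e + 1))) * Polynomial.X ^ ((e : ℕ) + 1)).map
        (algebraMap (MvPolynomial (Fin (k + 3) × Fin (k + 3)) ℂ)
          (FractionRing (MvPolynomial (Fin (k + 3) × Fin (k + 3)) ℂ))))) :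
    (k + 3) ^ 3 ≤ 2 * m ^ 2 := by
  obtain ⟨a, b, g, hg, hcert⟩ := exists_certificate_of_separable_map _
    (PerfectField.separable_iff_squarefree.mpr hsq)
  exact cube_le_two_mul_sq_of_raySeparable A B hA hB α β c hc hβ hdet hper hm2 D hD hdeg hJ1 hJtop hJ a b g hg hcert

end Summit.ValiantsHypothesis.ValiantsHypothesis.Theorems.GrenetZeonTwoDimCoefficients.ScalingClosure

end
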